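import Summits.HodgeConjecture.HodgeConjecture.Theorems.Ring2AbelianAllCMTwistedCarriersDefs
import Summits.HodgeConjecture.HodgeConjecture.Theorems.VHCAbelianSchemesRoadDesignDefs
import HarnessLib

/-!
# Ring 2 / AbelianAll (André column) — the nodes «CM-ANCHORED CARRIERS FOR ALGEBRAIC CLASSES» and «PINNED DESIGNS ON ABELIAN VARIETIES»
# of the implication table (definitions only)

research route, not a corollary; conditional on HC_CM plus one named minimal statement.

DEFINITIONS ONLY (nothing asserted, nothing proved; `HC_CM` absent). PART AA-g (gen 58) named the node `CMAnchoredCarriers 𝒪` /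
`CMTwistedCarriers`: `𝒪`-carriers for EVERY rational `(p,p)` class on every polarised CM abelian `n`-fold (`2 ≤ p`, `2p + 4 ≤ n`) — a
statement STRONGER than `HC_CM`. PART AB (gen 59, companion files `VHCAbelianSchemesRoadCompactPencilDesigns`,
`Ring2AbelianAllCMAlgebraicCarriers`) serves ALGEBRAIC classes instead, so that the carrier demand contains no Hodge-theoretic unknown
(Bloch's semiregular-representative problem `a·z₀ + b·l₀ᵖ` for KNOWN algebraic cycles), and names the two resulting nodes of the §AbelianAll
implication table of `RING2-MAP.md`, in the vocabulary of PART AA-a (`AnchoredCarrierAt`) and PART Z-a (`PinnedDesignAt`):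

* `algebraicServedClasses p` (served-class map, reducible): the algebraic classes `algebraicClasses X p` (rationality is asked separately by
  `AnchoredCarrierAt`).
* `CMAlgebraicCarriers 𝒪` (`@[conjecture]`, door-generic): for all `n`, `p` with `2 ≤ p`, `2p + 4 ≤ n` (the range of Lemme 6.3.1 at
  `n = 2·dim A`), `AnchoredCarrierAt 𝒪 n p (cmPolarisedAnchor n) (algebraicServedClasses p)` — on every `X ≅` CM abelian `n`-fold, for every
  polarisation class `θ` and every rational ALGEBRAIC class `w` of codimension `p`, an `𝒪`-admissible datum ON `X` with
  `κ_p = a·w + c_p·θᵖ`, `a ≠ 0`, `κ_q = c_q·θ^q`. With `HC_CM`, Lemme 6.3.1 and the door it gives `HC_AV` (companion proof file; `HC_CM`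
  LOAD-BEARING); it is implied by `CMAnchoredCarriers 𝒪` and by `AbelianDesigns 𝒪`, and equivalent to `CMAnchoredCarriers 𝒪` next to `HC_CM`.
* `CMAlgebraicTwistedCarriers` (`@[conjecture]`): the same for the road's twisted door `twistedReflexiveClass C AdmTw`, every `C`
  (`AdmTw := gluableSigmaAdmissible ∨ bfSingleAdmissible`, as in the crux `SemiregularSheafRepresentativesTwAtDiag`).
* `AbelianDesigns 𝒪` (`@[conjecture]`, door-generic): PART Z's pinned design problem at EVERY mid-range cell — `PinnedDesignAt 𝒪 n p` for
  all `2 ≤ p ≤ n − 2` (every polarised abelian `n`-fold, every rational algebraic class). With the door it gives Grothendieck's transport of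
  algebraicity on every compact abelian pencil (`Ring2.Deform.CompactAbelianPencilVHC`), hence, with Lemmes 6.3.1–6.3.3, `HC_AV` with
  `HC_CM` IDLE (companion proof file).
* `AbelianTwistedDesigns` (`@[conjecture]`): the same for the twisted door, every `C`.

All four nodes are OPEN, not in print (no semiregular representative theorem for algebraic cycles on abelian varieties is known beyond
Markman's secant sheaves; Bloch 1972 asks the question, Buchweitz–Flenner 2003 construct the semiregularity map), NOT implied by the Hodge
conjecture (a carrier is more than algebraicity) — HYPOTHESES wherever used, never cited as facts. References:
[cite: Bloch1972Semiregularity, Remark (7.5)] [cite: BuchweitzFlenner2003, §5 Thm. 5.1] [cite: Andre1996Motifs, §6.3 Lemme 6.3.1 and Remarque 2]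
[cite: Milne1999, §7 p. 72] [cite: Markman2025SecantWeil, §7.3 and Thm. 1.4.1] [cite: vanGeemen1994HodgeAV, §2.4].
-/

noncomputable section

open CategoryTheory CategoryTheory.Limits AlgebraicGeometry Topology

namespace Summit.HodgeConjecture.HodgeConjecture.Ring2.AbelianAll

-- the cell's namespace repeats the summit name (`Summit.HodgeConjecture.HodgeConjecture…`), as in every `Ring2*` file
set_option linter.dupNamespace false

open Literature.AlgebraicGeometry Literature.AlgebraicGeometry.Motives
open Literature.AlgebraicGeometry.HodgeTheory
open Literature.AlgebraicTopology.SingularHomology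
open Summit.Ventures.HSemireg (ObjClass)
open Summit.HodgeConjecture.HodgeConjecture.Ring2.SemiregularRepresentatives (AnchoredCarrierAt PinnedDesignAt)

/-- **Served classes: the ALGEBRAIC classes of codimension `p`** (`algebraicClasses X p`, the `ℂ`-span of fundamental classes of closed
subvarieties; rationality is asked separately by `AnchoredCarrierAt`). Reducible. [cite: VoisinHodgeI2002, §11.3 Prop. 11.20]
[cite: Bloch1972Semiregularity, Remark (7.5)] -/
abbrev algebraicServedClasses (p : ℕ) : ∀ X : SchemeOver ℂ, complexBetti X 2 → Set (complexBetti X (2 * p)) :=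
  fun X _ ↦ (algebraicClasses X p : Set (complexBetti X (2 * p)))

/-- **CM-ANCHORED CARRIERS FOR ALGEBRAIC CLASSES for the door `𝒪` (`CMAlgebraicCarriers 𝒪`)**: for all `n`, `p` with `2 ≤ p`, `2p + 4 ≤ n`,
on every complex scheme isomorphic to a CM abelian `n`-fold, for every polarisation class `θ` and every rational ALGEBRAIC class `w` of
codimension `p`: an `𝒪`-admissible datum `(I ∋ p, κ)` ON IT with `κ_p = a·w + c_p·θᵖ`, `a ≠ 0`, `κ_q = c_q·θ^q` (`q ∈ I`, `q ≠ p`) — a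
semiregular representative, modulo the `θ`-ray, of a KNOWN algebraic cycle on a CM abelian variety. With `HC_CM`, André's Lemme 6.3.1 and
the door's local variational Hodge statement it gives `HC_AV` (`HC_CM` load-bearing). OPEN; a HYPOTHESIS wherever used.
[cite: Bloch1972Semiregularity, Remark (7.5)] [cite: Andre1996Motifs, §6.3 Lemme 6.3.1] [cite: Milne1999, §7 p. 72] -/
@[conjecture] def CMAlgebraicCarriers (𝒪 : ObjClass) : Prop :=
  ∀ n p : ℕ, 2 ≤ p → 2 * p + 4 ≤ n → AnchoredCarrierAt 𝒪 n p (cmPolarisedAnchor n) (algebraicServedClasses p)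

/-- **CM-ANCHORED TWISTED CARRIERS FOR ALGEBRAIC CLASSES (`CMAlgebraicTwistedCarriers`)**: `CMAlgebraicCarriers` for the road's twisted door
`twistedReflexiveClass C AdmTw` — `B`-twisted admissible perfect complexes, `AdmTw := gluableSigmaAdmissible ∨ bfSingleAdmissible` — for
EVERY Chern character theory `C` on Betti cohomology. The `B_min` of PART AB next to `HC_CM`: ONE statement about known cycles on countably
many varieties which, with `HC_CM`, K-C, the door binder `TwistedPerfectDoor` and Lemme 6.3.1, gives `HC_AV` (companion proof file).
OPEN; not in print; a HYPOTHESIS wherever used. [cite: Bloch1972Semiregularity, Remark (7.5)] [cite: Markman2025SecantWeil, §7.3 and Thm. 1.4.1]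
[cite: BuchweitzFlenner2003, §5 Thm. 5.1] [cite: Andre1996Motifs, §6.3 Lemme 6.3.1] -/
@[conjecture] def CMAlgebraicTwistedCarriers : Prop :=
  ∀ C : ChernCharacterBetti, CMAlgebraicCarriers (twistedReflexiveClass C
    (fun n X₀ I E => Summit.Ventures.HSemireg.gluableSigmaAdmissible n X₀ I E ∨
      Literature.AlgebraicGeometry.HodgeTheory.bfSingleAdmissible n X₀ I E))

/-- **PINNED DESIGNS ON ALL POLARISED ABELIAN VARIETIES for the door `𝒪` (`AbelianDesigns 𝒪`)**: PART Z's pinned design problem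
`PinnedDesignAt 𝒪 n p` at EVERY mid-range cell `2 ≤ p ≤ n − 2` — on every `X ≅` an abelian `n`-fold, for every polarisation class `θ` and
every rational ALGEBRAIC class `w` of codimension `p`, an `𝒪`-datum on `X` with `κ_p = a·w + c_p·θᵖ`, `a ≠ 0`, sides on the `θ`-ray. With the
door it gives transport of algebraicity on every compact abelian pencil (`Ring2.Deform.CompactAbelianPencilVHC`, André's Remarque-2 input),
hence `HC_AV` with Lemmes 6.3.1–6.3.3 and `HC_CM` IDLE (companion proof file). OPEN; a HYPOTHESIS wherever used.
[cite: Bloch1972Semiregularity, Remark (7.5)] [cite: vanGeemen1994HodgeAV, §2.4] [cite: Andre1996Motifs, §6.3 Remarque 2 (p. 33)] -/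
@[conjecture] def AbelianDesigns (𝒪 : ObjClass) : Prop :=
  ∀ n p : ℕ, 2 ≤ p → p + 2 ≤ n → PinnedDesignAt 𝒪 n p

/-- **PINNED TWISTED DESIGNS ON ALL POLARISED ABELIAN VARIETIES (`AbelianTwistedDesigns`)**: `AbelianDesigns` for the road's twisted door
`twistedReflexiveClass C AdmTw`, every Chern character theory `C`. OPEN; not in print; a HYPOTHESIS wherever used.
[cite: Bloch1972Semiregularity, Remark (7.5)] [cite: Markman2025SecantWeil, §7.3] [cite: BuchweitzFlenner2003, §5 Thm. 5.1] -/
@[conjecture] def AbelianTwistedDesigns : Prop :=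
  ∀ C : ChernCharacterBetti, AbelianDesigns (twistedReflexiveClass C
    (fun n X₀ I E => Summit.Ventures.HSemireg.gluableSigmaAdmissible n X₀ I E ∨
      Literature.AlgebraicGeometry.HodgeTheory.bfSingleAdmissible n X₀ I E))

end Summit.HodgeConjecture.HodgeConjecture.Ring2.AbelianAll

end
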